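import Literature.AlgebraicGeometry.Resolution.AlterationsSemiStableResolution
import Literature.AlgebraicGeometry.Resolution.AlterationsEnlargingZ
import Literature.AlgebraicGeometry.Resolution.BlowupsProduct
import Literature.AlgebraicGeometry.Resolution.BlowupsFlatBaseChange
import Literature.AlgebraicGeometry.Resolution.MarkedIdealsLemmas
import HarnessLib

/-!
# De Jong's alteration theorem: the boundary of Situation 4.23 is a divisor (de Jong 1996, 4.24)

Topic: `Literature/AlgebraicGeometry/Resolution`. In de Jong 1996, 4.24 the boundary
`Z = τ₁(Y) ∪ … ∪ τₙ(Y) ∪ f⁻¹(D)` of a pair in Situation 4.23 (`DeJong1996.SemiStablePair f g D τ`)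
is asserted to be a divisor (2.3: a closed subscheme regularly embedded of codimension 1, i.e. an
effective Cartier divisor) in one sentence:

> "Furthermore, it is a divisor, as `D` is a divisor and `τᵢ(Y)` is a divisor." (p. 75)

This file PROVES that sentence up to its second input, along its own three steps:

* **"`D` is a divisor"** — a strict normal crossings divisor `D` on an integral locally
  Noetherian scheme is (the support of) an effective Cartier divisor, namely of its radical ideal
  sheaf `I_D` (`IsStrictNormalCrossingsDivisor.isEffectiveCartier_vanishingIdeal`): at `p ∈ D`
  the stalk `(I_D)_p = (x₁ ⋯ x_r)` is principal and non-zero. This rests on a general PROVED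
  criterion, `isEffectiveCartier_of_stalkIdeal_eq_span_singleton`: **an ideal sheaf on an
  integral locally Noetherian scheme whose stalk at every point of its support is a non-zero
  principal ideal is an effective Cartier divisor** (Nakayama picks a section whose germ
  generates; the finitely many generators of `I(U)` become multiples of it on a smaller affine
  open; a non-zero section of an integral scheme is a non-zero-divisor);
* **the pull-back `f⁻¹(D)`** is the support of the effective Cartier divisor `f*I_D`, `f` being
  flat (`IsEffectiveCartier.comap_of_flat`, `Scheme.IdealSheafData.support_comap`);
* **"`τᵢ(Y)` is a divisor"** — each section `τᵢ(Y) ⊂ X` (a section of `f` inside its smooth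
  locus, where `f` is smooth of relative dimension one) is the support of an effective Cartier
  divisor: vendored as the NAMED FACT `DeJong1996SectionIsDivisor` (the node carrying "a section
  of a smooth curve is a regular immersion of codimension one", EGA IV₄ 17.12.1 / 19.1.5);
* sums of effective Cartier divisors (`IsEffectiveCartier.mul`, products of the ideal sheaves;
  finite unions of supports, `exists_isEffectiveCartier_iUnion`), whence
  `DeJong1996.SemiStablePair.exists_isEffectiveCartier_semiStableBoundary`: given
  `DeJong1996SectionIsDivisor`, the boundary of a pair in Situation 4.23 is the support of an
  effective Cartier divisor (the field `exists_isEffectiveCartier` of Situation 4.25,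
  `DeJong1996.NormalFormPair`).

## Sources

* A. J. de Jong, *Smoothness, semi-stability and alterations*, Publ. Math. IHÉS 83 (1996) 51–93:
  2.3, 2.4 (p. 55), 4.23, 4.24 (p. 75).
* The Stacks Project, Tags 01WR–01WU (effective Cartier divisors and their sums), 0BI9 (strict
  normal crossings divisors are effective Cartier divisors).
* A. Grothendieck, J. Dieudonné, *EGA IV₄* (1967), 17.12.1 (sections of smooth morphisms are
  regular immersions).
-/

noncomputable section

open CategoryTheory CategoryTheory.Limits AlgebraicGeometry TopologicalSpace Topology
  IsLocalRing

namespace Literature.AlgebraicGeometry.Resolution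

universe u

open Scheme.IdealSheafData

/-! ## Local algebra: a generating set of a principal ideal of a local ring contains a generator -/

/-- In a local ring, if a set `T` generates the principal ideal `(g)` with `g ≠ 0`, then some
member of `T` generates it (Nakayama: otherwise `T ⊆ 𝔪 · (g)`, so `(g) ⊆ 𝔪 · (g)` and `g = 0`).
[folklore] -/
theorem exists_mem_span_singleton_eq_of_span_eq {R : Type*} [CommRing R] [IsLocalRing R]
    {T : Set R} {g : R} (hg : g ≠ 0) (h : Ideal.span T = Ideal.span {g}) :
    ∃ t ∈ T, Ideal.span {t} = Ideal.span {g} := by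
  by_contra hne
  push Not at hne
  have hT : T ⊆ (maximalIdeal R • Ideal.span {g} : Ideal R) := by
    intro t ht
    have htg : t ∈ Ideal.span {g} := h ▸ Ideal.subset_span ht
    obtain ⟨c, rfl⟩ := Ideal.mem_span_singleton'.mp htg
    have hc : c ∈ maximalIdeal R := by
      by_contra hcu
      have hu : IsUnit c := by
        by_contra hnu
        exact hcu ((mem_maximalIdeal _).mpr hnu)
      exact hne _ ht (Ideal.span_singleton_mul_left_unit hu g)
    rw [Ideal.smul_eq_mul]
    exact Ideal.mul_mem_mul hc (Ideal.mem_span_singleton_self g)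
  have hle : (Ideal.span {g} : Ideal R) ≤ maximalIdeal R • Ideal.span {g} := by
    have hle' : Ideal.span T ≤ maximalIdeal R • Ideal.span {g} := Ideal.span_le.mpr hT
    rwa [h] at hle'
  have hbot := Submodule.eq_bot_of_le_smul_of_le_jacobson_bot (maximalIdeal R) (Ideal.span {g})
    (Submodule.fg_span_singleton g) hle (maximalIdeal_le_jacobson ⊥)
  exact hg (Ideal.span_singleton_eq_bot.mp hbot)

/-! ## Spreading out a stalkwise generator -/

section Spread

variable {X : Scheme.{u}}

/-- **Spreading out.** If the stalk `I_x` of an ideal sheaf on a locally Noetherian scheme is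
generated by the germ of a section `i ∈ I(U)`, then `I(V) = (i|_V)` on some affine open
neighbourhood `V ⊆ U` of `x`: the finitely many generators of `I(U)` are multiples of `i` in
`𝒪_{X,x}`, hence on a common neighbourhood. [folklore] -/
theorem exists_ideal_eq_span_singleton_of_stalkIdeal_eq [IsLocallyNoetherian X]
    (I : X.IdealSheafData) {x : X} (U : X.affineOpens) (hxU : x ∈ (U : X.Opens)) (i : Γ(X, U))
    (hi : i ∈ I.ideal U) (h : stalkIdeal I x = Ideal.span {(X.presheaf.germ U x hxU).hom i}) :
    ∃ (V : X.affineOpens) (hVU : (V : X.Opens) ≤ U), x ∈ (V : X.Opens) ∧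
      I.ideal V = Ideal.span {X.presheaf.map (homOfLE hVU).op i} := by
  classical
  -- generators of `I(U)`
  haveI : IsNoetherianRing Γ(X, U) := IsLocallyNoetherian.component_noetherian U
  obtain ⟨S, hS⟩ : (I.ideal U).FG := IsNoetherian.noetherian _
  -- each generator is a multiple of `i` near `x`
  have key : ∀ s : ↥S, ∃ (W : X.Opens) (hW : W ≤ (U : X.Opens)), x ∈ W ∧ ∃ c : Γ(X, W),
      X.presheaf.map (homOfLE hW).op s.1 = c * X.presheaf.map (homOfLE hW).op i := by
    intro s
    have hs : (X.presheaf.germ U x hxU).hom s.1 ∈ stalkIdeal I x :=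
      map_germ_le_stalkIdeal I U hxU (Ideal.mem_map_of_mem _ (hS ▸ Ideal.subset_span s.2))
    rw [h, Ideal.mem_span_singleton'] at hs
    obtain ⟨c, hc⟩ := hs
    -- `c` is a germ of a section `c'` on some `W' ∋ x`, `W' ⊆ U`
    obtain ⟨W', hW'U, hxW', c', hc'⟩ := X.presheaf.exists_le_germ_eq c hxU
    -- the two sections `s|W'` and `c' · i|W'` have the same germ, hence agree near `x`
    have hgerm : (X.presheaf.germ W' x hxW').hom (X.presheaf.map (homOfLE hW'U).op s.1) =
        (X.presheaf.germ W' x hxW').hom (c' * X.presheaf.map (homOfLE hW'U).op i) := by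
      rw [map_mul]
      change X.presheaf.germ W' x hxW' (X.presheaf.map (homOfLE hW'U).op s.1) =
        X.presheaf.germ W' x hxW' c' * X.presheaf.germ W' x hxW' (X.presheaf.map (homOfLE hW'U).op i)
      rw [TopCat.Presheaf.germ_res_apply, TopCat.Presheaf.germ_res_apply, hc']
      exact hc.symm
    obtain ⟨W, hxW, iU, iV, hWeq⟩ := X.presheaf.germ_eq x hxW' hxW' _ _ hgerm
    have hWW' : W ≤ W' := iU.le
    refine ⟨W, hWW'.trans hW'U, hxW, X.presheaf.map (homOfLE hWW').op c', ?_⟩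
    have e1 : X.presheaf.map iU.op (X.presheaf.map (homOfLE hW'U).op s.1) =
        X.presheaf.map (homOfLE (hWW'.trans hW'U)).op s.1 := by
      rw [← CommRingCat.comp_apply, ← Functor.map_comp]
      rfl
    have e2 : X.presheaf.map iV.op (c' * X.presheaf.map (homOfLE hW'U).op i) =
        X.presheaf.map (homOfLE hWW').op c' * X.presheaf.map (homOfLE (hWW'.trans hW'U)).op i := by
      rw [map_mul, ← CommRingCat.comp_apply (X.presheaf.map (homOfLE hW'U).op),
        ← Functor.map_comp]
      rfl
    rw [← e1, ← e2]
    exact hWeq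
  choose W hWU hxW c hc using key
  -- a common affine neighbourhood inside all the `W s`
  have hopen : IsOpen (⋂ s : ↥S, (W s : Set X)) := isOpen_iInter_of_finite fun s => (W s).isOpen
  obtain ⟨V, hV, hxV, hVsub⟩ := exists_isAffineOpen_mem_and_subset (X := X) (x := x)
    (U := (⟨⋂ s : ↥S, (W s : Set X), hopen⟩ : X.Opens) ⊓ U) ⟨Set.mem_iInter.mpr hxW, hxU⟩
  have hVU : V ≤ (U : X.Opens) := fun y hy => (hVsub hy).2
  have hVW : ∀ s : ↥S, V ≤ W s := fun s y hy => Set.mem_iInter.mp (hVsub hy).1 s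
  refine ⟨⟨V, hV⟩, hVU, hxV, ?_⟩
  apply le_antisymm
  · -- `I(V)` is generated by the restrictions of the generators of `I(U)`
    rw [← I.map_ideal (U := ⟨V, hV⟩) (V := U) hVU, ← hS, Ideal.map_span, Ideal.span_le]
    rintro _ ⟨s, hs, rfl⟩
    rw [SetLike.mem_coe, Ideal.mem_span_singleton']
    refine ⟨X.presheaf.map (homOfLE (hVW ⟨s, hs⟩)).op (c ⟨s, hs⟩), ?_⟩
    have := congrArg (X.presheaf.map (homOfLE (hVW ⟨s, hs⟩)).op) (hc ⟨s, hs⟩)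
    rw [map_mul, ← CommRingCat.comp_apply, ← Functor.map_comp, ← CommRingCat.comp_apply,
      ← Functor.map_comp] at this
    exact this.symm
  · rw [Ideal.span_singleton_le_iff_mem, ← I.map_ideal (U := ⟨V, hV⟩) (V := U) hVU]
    exact Ideal.mem_map_of_mem _ hi

/-- A section of an integral scheme with a non-zero germ is a non-zero-divisor. [folklore] -/
theorem mem_nonZeroDivisors_of_germ_ne_zero [IsIntegral X] {U : X.Opens} {x : X} (hxU : x ∈ U)
    (s : Γ(X, U)) (hs : (X.presheaf.germ U x hxU).hom s ≠ 0) : s ∈ nonZeroDivisors Γ(X, U) := by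
  haveI : Nonempty U := ⟨⟨x, hxU⟩⟩
  refine mem_nonZeroDivisors_of_ne_zero fun h0 => hs ?_
  rw [h0, map_zero]

end Spread

/-! ## Stalkwise principal ideal sheaves are effective Cartier divisors -/

/-- **An ideal sheaf on an integral locally Noetherian scheme whose stalk at every point of its
support is principal and non-zero is an effective Cartier divisor** (Stacks 01WR/01WS: the
subscheme is locally cut out by one non-zero-divisor). Off the support `I = 𝒪_X` locally; at a
point of the support a generator of `I_x` may be taken to be the germ of a section of `I`
(`exists_mem_span_singleton_eq_of_span_eq`), which then generates `I` on a neighbourhood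
(`exists_ideal_eq_span_singleton_of_stalkIdeal_eq`) and is a non-zero-divisor there, `X` being
integral. [cite: StacksProject, Tag 01WS] -/
theorem isEffectiveCartier_of_stalkIdeal_eq_span_singleton {X : Scheme.{u}} [IsIntegral X]
    [IsLocallyNoetherian X] {I : X.IdealSheafData}
    (h : ∀ x ∈ I.support, ∃ g : X.presheaf.stalk x, g ≠ 0 ∧ stalkIdeal I x = Ideal.span {g}) :
    IsEffectiveCartier I := by
  intro x
  obtain ⟨U, hU, hxU, -⟩ :=
    exists_isAffineOpen_mem_and_subset (X := X) (x := x) (U := ⊤) (Opens.mem_top x)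
  by_cases hx : x ∈ I.support
  · obtain ⟨g, hg0, hIg⟩ := h x hx
    -- a section `i ∈ I(U)` whose germ generates `I_x`
    have hspan : Ideal.span ((X.presheaf.germ U x hxU).hom '' (I.ideal ⟨U, hU⟩)) =
        Ideal.span {g} := by
      rw [← hIg, stalkIdeal_eq_map_germ I ⟨U, hU⟩ hxU, Ideal.map]
    obtain ⟨_, ⟨i, hi, rfl⟩, hgen⟩ := exists_mem_span_singleton_eq_of_span_eq hg0 hspan
    have hIi : stalkIdeal I x = Ideal.span {(X.presheaf.germ U x hxU).hom i} := by
      rw [hgen, hIg]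
    have hi0 : (X.presheaf.germ U x hxU).hom i ≠ 0 := by
      intro h0
      rw [h0, Ideal.span_singleton_eq_bot.mpr rfl, eq_comm, Ideal.span_singleton_eq_bot] at hgen
      exact hg0 hgen
    obtain ⟨V, hVU, hxV, hIV⟩ :=
      exists_ideal_eq_span_singleton_of_stalkIdeal_eq I ⟨U, hU⟩ hxU i hi hIi
    refine ⟨V, hxV, _, mem_nonZeroDivisors_of_germ_ne_zero hxV _ ?_, hIV⟩
    change X.presheaf.germ V x hxV (X.presheaf.map (homOfLE hVU).op i) ≠ 0
    rw [TopCat.Presheaf.germ_res_apply]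
    exact hi0
  · -- off the support: a section of `I(U)` does not vanish at `x`, and is a unit on `D(f)`
    rw [mem_support_iff_of_mem (U := ⟨U, hU⟩) hxU, Scheme.mem_zeroLocus_iff] at hx
    push Not at hx
    obtain ⟨f, hfI, hxf⟩ := hx
    refine ⟨X.affineBasicOpen f, hxf, 1, one_mem _, ?_⟩
    rw [Ideal.span_singleton_one, eq_top_iff, ← I.map_ideal_basicOpen]
    have hu : IsUnit (X.presheaf.map (homOfLE (X.basicOpen_le f)).op f) := by
      have := hU.isLocalization_basicOpen f
      exact IsLocalization.Away.algebraMap_isUnit (S := Γ(X, X.basicOpen f)) f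
    exact (Ideal.eq_top_of_isUnit_mem _ (Ideal.mem_map_of_mem _ hfI) hu).ge

/-! ## "`D` is a divisor": strict normal crossings divisors are effective Cartier divisors -/

/-- **A strict normal crossings divisor on an integral locally Noetherian scheme is (the support
of) an effective Cartier divisor**: its radical ideal sheaf `I_D` is locally generated by one
non-zero-divisor (Stacks 0BI9: "an effective Cartier divisor `D ⊂ X` such that …"; here from the
local form of the definition, `(I_D)_p = (x₁ ⋯ x_r)` with `x₁, …, x_r` part of a regular system of
parameters, hence non-zero). [cite: StacksProject, Tag 0BI9] -/
theorem IsStrictNormalCrossingsDivisor.isEffectiveCartier_vanishingIdeal {Y : Scheme.{u}}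
    [IsIntegral Y] [IsLocallyNoetherian Y] {D : Set Y} (hD : IsStrictNormalCrossingsDivisor Y D) :
    IsEffectiveCartier (vanishingIdeal ⟨D, hD.isClosed⟩) := by
  have hD' := (isStrictNormalCrossingsDivisor_iff_stalkIdeal Y D).mp hD
  have hcl : (⟨closure D, isClosed_closure⟩ : Closeds Y) = ⟨D, hD.isClosed⟩ :=
    Closeds.ext hD.isClosed.closure_eq
  refine isEffectiveCartier_of_stalkIdeal_eq_span_singleton fun p hp => ?_
  have hpD : p ∈ D := by
    rw [← SetLike.mem_coe, coe_support_vanishingIdeal] at hp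
    exact hp
  obtain ⟨hreg, r, e, x, y, -, hdim, hspan, hI⟩ := hD'.2 p hpD
  haveI := hreg
  haveI := isDomain_of_isRegularLocalRing (Y.presheaf.stalk p)
  rw [hcl] at hI
  refine ⟨∏ i, x i, ?_, hI⟩
  rw [Finset.prod_ne_zero_iff]
  intro i _
  have hz : Ideal.span (Set.range (Fin.append x y)) = maximalIdeal (Y.presheaf.stalk p) := by
    rw [range_fin_append]
    exact hspan
  rw [show x i = Fin.append x y (Fin.castAdd e i) from (Fin.append_left x y i).symm]
  exact ne_zero_of_rsop (Fin.append x y) hz hdim _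

/-- A strict normal crossings divisor on an integral locally Noetherian scheme is the support of
an effective Cartier divisor. [cite: StacksProject, Tag 0BI9] -/
theorem IsStrictNormalCrossingsDivisor.exists_isEffectiveCartier {Y : Scheme.{u}} [IsIntegral Y]
    [IsLocallyNoetherian Y] {D : Set Y} (hD : IsStrictNormalCrossingsDivisor Y D) :
    ∃ I : Y.IdealSheafData, IsEffectiveCartier I ∧ (I.support : Set Y) = D :=
  ⟨_, hD.isEffectiveCartier_vanishingIdeal, coe_support_vanishingIdeal _⟩

/-! ## Pull-backs along flat morphisms and finite unions -/

/-- The preimage of the support of an effective Cartier divisor under a flat morphism is the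
support of an effective Cartier divisor (the pulled-back ideal sheaf).
[cite: GortzWedhorn2020, Prop. 13.91] -/
theorem exists_isEffectiveCartier_preimage_of_flat {X Y : Scheme.{u}} (f : X ⟶ Y) [Flat f]
    {D : Set Y} (h : ∃ I : Y.IdealSheafData, IsEffectiveCartier I ∧ (I.support : Set Y) = D) :
    ∃ J : X.IdealSheafData, IsEffectiveCartier J ∧ (J.support : Set X) = f ⁻¹' D := by
  obtain ⟨I, hI, hID⟩ := h
  refine ⟨I.comap f, hI.comap_of_flat f, ?_⟩
  rw [support_comap, Closeds.coe_preimage, hID]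

/-- A finite union of supports of effective Cartier divisors is the support of an effective
Cartier divisor (the product of the ideal sheaves, Stacks 01WU). [cite: StacksProject, Tag 01WU] -/
theorem exists_isEffectiveCartier_iUnion {X : Scheme.{u}} {ι : Type*} [Finite ι] (Z : ι → Set X)
    (h : ∀ i, ∃ I : X.IdealSheafData, IsEffectiveCartier I ∧ (I.support : Set X) = Z i) :
    ∃ I : X.IdealSheafData, IsEffectiveCartier I ∧ (I.support : Set X) = ⋃ i, Z i := by
  classical
  haveI := Fintype.ofFinite ι
  suffices H : ∀ s : Finset ι, ∃ I : X.IdealSheafData, IsEffectiveCartier I ∧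
      (I.support : Set X) = ⋃ i ∈ s, Z i by
    obtain ⟨I, hI, hIs⟩ := H Finset.univ
    refine ⟨I, hI, ?_⟩
    rw [hIs]
    simp only [Finset.mem_univ, Set.iUnion_true]
  intro s
  induction s using Finset.induction_on with
  | empty =>
    exact ⟨⊤, isEffectiveCartier_top, by simp [support_top]⟩
  | insert a s ha ih =>
    obtain ⟨I, hI, hIs⟩ := ih
    obtain ⟨J, hJ, hJa⟩ := h a
    refine ⟨J * I, hJ.mul hI, ?_⟩
    rw [support_mul, Closeds.coe_sup, hIs, hJa, Finset.set_biUnion_insert]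

/-! ## "`τᵢ(Y)` is a divisor" as a named fact; the boundary is a divisor -/

/-- NAMED FACT — **de Jong 1996, 4.24: "`τᵢ(Y)` is a divisor".** For a pair in Situation 4.23
over an algebraically closed field (`DeJong1996.SemiStablePair f g D τ`: the `τᵢ` are sections of
the semi-stable curve `f : X → Y` into its smooth locus), each `τᵢ(Y) ⊂ X` is a divisor (2.3: a
closed subscheme regularly embedded of codimension 1, i.e. an effective Cartier divisor):
rendered as "the closed subset `τᵢ(Y)` is the support of an effective Cartier divisor"
(`IsEffectiveCartier`), which is what Situation 4.25 records. (A section of a smooth separated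
morphism of relative dimension one is a regular closed immersion of codimension one, EGA IV₄
17.12.1; at `x = τᵢ(y)` the kernel of `𝒪_{X,x} → 𝒪_{Y,y}` is generated by one regular
parameter.) Users take `(h : DeJong1996SectionIsDivisor)`. [cite: DeJong1996, 4.24, p. 75] -/
def DeJong1996SectionIsDivisor : Prop :=
  ∀ (k : Type u) [Field k] [IsAlgClosed k] (X Y : Scheme.{u}) (f : X ⟶ Y)
    (g : Y ⟶ Spec (.of k)) (D : Set Y) (n : ℕ) (τ : Fin n → (Y ⟶ X)),
    DeJong1996.SemiStablePair f g D τ →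
      ∀ i, ∃ I : X.IdealSheafData, IsEffectiveCartier I ∧ (I.support : Set X) = Set.range (τ i)

namespace DeJong1996.SemiStablePair

variable {k : Type u} [Field k] {X Y : Scheme.{u}} {f : X ⟶ Y} {g : Y ⟶ Spec (.of k)}
  {D : Set Y} {n : ℕ} {τ : Fin n → (Y ⟶ X)}

/-- In Situation 4.23, `f⁻¹(D)` is the support of an effective Cartier divisor: `D` is one on
the nonsingular `Y` and `f` is flat ("`D` is a divisor", 4.24). [cite: DeJong1996, 4.24, p. 75] -/
theorem exists_isEffectiveCartier_preimage (hS : SemiStablePair f g D τ) :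
    ∃ J : X.IdealSheafData, IsEffectiveCartier J ∧ (J.support : Set X) = f ⁻¹' D := by
  haveI := hS.isIntegral_base
  haveI : IsNoetherian Y := isNoetherian_of_isProjectiveOver g hS.isProjectiveOver_base
  haveI := hS.isSemiStableCurve.flat
  exact exists_isEffectiveCartier_preimage_of_flat f
    hS.isStrictNormalCrossingsDivisor.exists_isEffectiveCartier

/-- **de Jong 1996, 4.24: "Furthermore, it is a divisor, as `D` is a divisor and `τᵢ(Y)` is a
divisor"** — given that the sections are divisors (`DeJong1996SectionIsDivisor`), the boundary
`Z = ⋃ᵢ τᵢ(Y) ∪ f⁻¹(D)` of a pair in Situation 4.23 over an algebraically closed field is the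
support of an effective Cartier divisor. [cite: DeJong1996, 4.24, p. 75] -/
theorem exists_isEffectiveCartier_semiStableBoundary [IsAlgClosed k]
    (h : DeJong1996SectionIsDivisor.{u}) (hS : SemiStablePair f g D τ) :
    ∃ I : X.IdealSheafData, IsEffectiveCartier I ∧
      (I.support : Set X) = semiStableBoundary f D τ := by
  obtain ⟨I, hI, hIZ⟩ := exists_isEffectiveCartier_iUnion (fun i => Set.range (τ i))
    (h k X Y f g D n τ hS)
  obtain ⟨J, hJ, hJD⟩ := hS.exists_isEffectiveCartier_preimage
  refine ⟨I * J, hI.mul hJ, ?_⟩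
  rw [support_mul, Closeds.coe_sup, hIZ, hJD]
  rfl

end DeJong1996.SemiStablePair

end Literature.AlgebraicGeometry.Resolution

end
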